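import Summits.RiemannHypothesis.RiemannHypothesis.Theorems.TiltedLandingLaw421R3RateChildCountB
import Summits.RiemannHypothesis.RiemannHypothesis.Theorems.TiltedLandingLaw421R3NestedSign
import Summits.RiemannHypothesis.RiemannHypothesis.Theorems.TiltedLandingLaw421R3Lens1PinningIsoB

/-! # RATE CHILD COUNT (C) — the FRAME corollaries: R1a′ `FarChildExistsLawSep` at a SIMPLE lowest zero
(lens-2 g4, crux item stmt-RiemannHypothesis-33346; module 3/3 of the (CA557) cut; namespace `RhW08.ChildCount`; imports (B), the tree's
`…R3NestedSign` (`RhW08.NestedSign.im_mul_im_logDeriv_nonpos`, `exists_cofactor`: the Jensen sign of the cofactor field) and lens-1's tree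
`…R3Lens1PinningIsoB` (`RhW08.Lens1PinningIso.pinning_of_jensenIsolated'` — dirty feet allowed —, `JensenIsolated`); 0 `sorry`; v2 of the
module = crit-1 CUT-11b (l.7819): the `CleanFeet` binder of v1 is discharged by the primed pinning theorem and dropped.)

§5 ★★★ `exists_child_of_separated` (analysis form: `f` real entire of order `< 2`, `v` a simple `R/2`-isolated zero of `f⁽ʲ⁾` separated from the
taller zoo (C′) with `Im v < R/4`, no `NLEventOf f j` on the closed diameter, `f⁽ʲ⁺¹⁾ ≠ 0` at the feet ⇒ an upper zero `w` of `f⁽ʲ⁺¹⁾` with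
`f⁽ʲ⁾ w ≠ 0` in the closed Jensen disc), ★★★ `farChild_of_sep_simple` (the `EngineHyps5 2` / `Charged` / `IsLowest StTrkDQ` wrapper: `Charged ⇒`
no NL event of level `j` in the window ⊇ the diameter), `FarChildExistsLawSepSimple` (= R1a′ `RhW08.BurgersRateG3.FarChildExistsLawSep` VERBATIM +
binders simple · `Im v < R/4` · generic feet) + `_holds`.  §6 (v2, the `R/4` binder REMOVED): ★★★ `farChild_of_pinning` — R1a′ + binders simple ·
LOW-CLEAR (`Im v + Im z < |Re v − Re z|` for the other upper zeros `z` with `Im z ≤ Im v`), as a corollary of lens-1's landed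
`pinning_of_jensenIsolated'` (no clean-feet hypothesis); ★ `lowclear_of_R4` (v1's regime ⊆ v2's); `FarChildExistsLawSepSimpleJ` + `_holds`.
LEAVES of R1a′ after this module (separate items, none hides the crux): L1 multiplicity of `v`; L2ᴶ low-clearness beyond the strip (bites only when
`Im v + Im z ≥ R/2`).  Nothing here bears on the truth of RH; RH is not proved; 33346/33347 OPEN; checked ≠ proved. -/

noncomputable section

open Complex Metric Set
open scoped Real ComplexConjugate
open Literature.Topology.PlaneTopology
open Literature.Analysis.Complex
open RhW08.IsolatedTilt (pairQ)

namespace RhW08.ChildCount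

/-! ## §5 the FRAME: `f` real entire of order `< 2`, `v` a simple isolated separated lowest zero of `f⁽ʲ⁾` with `Im v < R/4`,
no NL event of level `j` on the closed diameter (⇐ `Charged`, i.e. `¬ TiltReady` at level `j`), generic feet ⇒ R1a′'s conclusion -/

open Summit.RiemannHypothesis.RiemannHypothesis.Theorems.Splittings.JensenWindow (RealEntireLt2) in
open RhIdea6.G17.W07C7 (NLEventOf) in
set_option maxHeartbeats 1600000 in
/-- ★★★ (K) **EXISTENCE + LOCALISATION of the nested moving child** (analysis form).  `f` real entire of order `< 2`; `v` a SIMPLE upper zero of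
`G = f⁽ʲ⁾`, ISOLATED (`|Re z − Re v| < R/2 ⇒ z ∈ {v, v̄}`), SEPARATED from every strictly taller zero (lens-1's C′), `Im v < R/4`; NO NL EVENT of
level `j` on the closed diameter `|x − Re v| ≤ Im v`; `f⁽ʲ⁺¹⁾ ≠ 0` at the two feet `Re v ± Im v`.  Then `f⁽ʲ⁺¹⁾` has an upper non-real zero `w`
with `f⁽ʲ⁾(w) ≠ 0` in the closed Jensen disc `‖w − Re v‖ ≤ Im v`. -/
theorem exists_child_of_separated {f : ℂ → ℂ} (hf : RealEntireLt2 f) (j : ℕ) {v : ℂ} {R : ℝ}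
    (hv : iteratedDeriv j f v = 0) (hv0 : 0 < v.im) (hsimp : iteratedDeriv (j + 1) f v ≠ 0)
    (hiso : ∀ z : ℂ, iteratedDeriv j f z = 0 → |z.re - v.re| < R / 2 → z = v ∨ z = conj v)
    (hsep : ∀ z : ℂ, iteratedDeriv j f z = 0 → v.im < z.im → v.im + z.im < |v.re - z.re|)
    (hR4 : v.im < R / 4) (hnoNL : ∀ x : ℝ, |x - v.re| ≤ v.im → ¬ NLEventOf f j x)
    (hfeet : iteratedDeriv (j + 1) f ((v.re : ℂ) + v.im) ≠ 0 ∧ iteratedDeriv (j + 1) f ((v.re : ℂ) - v.im) ≠ 0) :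
    ∃ w : ℂ, iteratedDeriv (j + 1) f w = 0 ∧ iteratedDeriv j f w ≠ 0 ∧ 0 < w.im ∧ ‖w - (v.re : ℂ)‖ ≤ v.im := by
  classical
  have hG : RealEntireLt2 (iteratedDeriv j f) := RhW08.WindowLoss.realEntireLt2_iteratedDeriv hf j
  set G := iteratedDeriv j f with hGdef
  have hG1 : iteratedDeriv (j + 1) f = deriv G := by rw [iteratedDeriv_succ]
  have hG2 : iteratedDeriv (j + 2) f = deriv (deriv G) := by
    rw [show j + 2 = j + 1 + 1 from rfl, iteratedDeriv_succ, iteratedDeriv_succ]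
  obtain ⟨h, hhd, ⟨ρ, C, hρ0, hρ, hgr⟩, hreal, hfac⟩ := RhW08.NestedSign.exists_cofactor hG hv hv0.ne'
  have hderiv : ∀ z, deriv G z = 2 * (z - v.re) * h z + pairQ v.re v.im z * deriv h z := by
    intro z
    have e : G = fun w => pairQ v.re v.im w * h w := funext hfac
    rw [e]
    exact ((RhW07.Law421.SuccessorCertificate.hasDerivAt_quadP v.re v.im z).mul (hhd z).hasDerivAt).deriv
  -- simplicity of `v` ⇒ the cofactor does not vanish at `v`, `v̄`; isolation ⇒ nowhere on the closed Jensen disc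
  have hhv : h v ≠ 0 := by
    intro h0
    apply hsimp
    have hq : pairQ v.re v.im v = 0 := by
      rw [RhW08.IsolatedTilt.pairQ_eq_mul, Complex.re_add_im, sub_self, zero_mul]
    rw [hG1, hderiv v, h0, mul_zero, zero_add, hq, zero_mul]
  have hhvbar : h (conj v) ≠ 0 := by rw [apply_conj_eq_conj hhd hreal, map_ne_zero]; exact hhv
  have hh0 : ∀ z ∈ closedBall ((v.re : ℝ) : ℂ) v.im, h z ≠ 0 := by
    intro z hz h0
    rw [mem_closedBall, dist_eq_norm] at hz
    have hGz : G z = 0 := by rw [hfac z, h0, mul_zero]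
    have hre : |z.re - v.re| < R / 2 := by
      have h1 : |z.re - v.re| ≤ ‖z - (v.re : ℂ)‖ := by
        have := Complex.abs_re_le_norm (z - v.re); simpa only [sub_re, ofReal_re] using this
      linarith
    rcases hiso z hGz hre with hzv | hzv
    · exact hhv (hzv ▸ h0)
    · exact hhvbar (hzv ▸ h0)
  -- the Jensen sign on the whole circle (isolation, separation C′, `Im v < R/4`)
  have hsign : ∀ z : ℂ, ‖z - (v.re : ℂ)‖ = v.im → z.im * (deriv h z / h z).im ≤ 0 := by
    intro z hz
    have hzball : z ∈ closedBall ((v.re : ℝ) : ℂ) v.im := by rw [mem_closedBall, dist_eq_norm]; exact hz.le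
    refine RhW08.NestedSign.im_mul_im_logDeriv_nonpos hhd hρ0 hρ hgr hreal (hh0 z hzball) fun a' ha' => ?_
    have hGa : G a' = 0 := by rw [hfac a', ha', mul_zero]
    have hav : a' ≠ v := fun e => hhv (e ▸ ha')
    have hav' : a' ≠ conj v := fun e => hhvbar (e ▸ ha')
    have hfar : R / 2 ≤ |a'.re - v.re| := by
      by_contra hlt
      push Not at hlt
      rcases hiso a' hGa hlt with e | e
      · exact hav e
      · exact hav' e
    have hlow : |a'.re - v.re| - v.im ≤ ‖z - (a'.re : ℂ)‖ := by
      have h1 : |z.re - a'.re| ≤ ‖z - (a'.re : ℂ)‖ := by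
        have := Complex.abs_re_le_norm (z - a'.re); simpa only [sub_re, ofReal_re] using this
      have h2 : |z.re - v.re| ≤ v.im := by
        have := Complex.abs_re_le_norm (z - v.re); simp only [sub_re, ofReal_re] at this; linarith
      have h3 := abs_sub_le a'.re z.re v.re
      rw [abs_sub_comm a'.re z.re] at h3
      linarith
    by_cases htall : v.im < |a'.im|
    · rcases le_or_gt 0 a'.im with hnn | hneg
      · rw [abs_of_nonneg hnn] at htall ⊢
        have := hsep a' hGa htall
        rw [abs_sub_comm] at this
        linarith
      · rw [abs_of_neg hneg] at htall ⊢
        have hGa' : G (conj a') = 0 := by rw [apply_conj_eq_conj hG.diff hG.real, hGa, map_zero]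
        have := hsep (conj a') hGa' (by rw [conj_im]; exact htall)
        rw [conj_im, conj_re, abs_sub_comm] at this
        linarith
    · push Not at htall
      linarith
  -- no NL event on the closed diameter ⇒ the `GG″ < 0` shape of §4 (isolation: `G ≠ 0` on the diameter)
  have hnoNL' : ∀ x : ℝ, |x - v.re| ≤ v.im → (deriv G x).re = 0 → (G x).re * (deriv (deriv G) x).re < 0 := by
    intro x hx h1
    have hGx : (G x).re ≠ 0 := by
      intro h0
      have hGx0 : G x = 0 := Complex.ext (by rw [zero_re]; exact h0) (by rw [zero_im]; exact hG.real x)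
      have hx' : |(x : ℂ).re - v.re| < R / 2 := by rw [ofReal_re]; linarith
      rcases hiso x hGx0 hx' with e | e
      · have := congrArg Complex.im e; rw [ofReal_im] at this; linarith
      · have := congrArg Complex.im e; rw [ofReal_im, conj_im] at this; linarith
    have hn := hnoNL x hx
    unfold NLEventOf at hn
    rw [← hGdef, hG1, hG2] at hn
    by_contra hge
    push Not at hge
    exact hn ⟨h1, hGx, hge⟩
  have hfeet' : deriv G ((v.re : ℂ) + v.im) ≠ 0 ∧ deriv G ((v.re : ℂ) - v.im) ≠ 0 := by rw [← hG1]; exact hfeet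
  obtain ⟨w, hw1, hw2, hw3, hw4⟩ :=
    exists_upper_child (ρ := 2 * v.im) hv0 (by linarith) hG.diff hhd hfac hG.real hreal hh0 hsign hnoNL' hfeet'
  exact ⟨w, by rw [hG1]; exact hw1, hw2, hw3, hw4⟩

open Summit.RiemannHypothesis.RiemannHypothesis.Theorems.Splittings.JensenWindow (RealEntireLt2) in
open RhIdea6.G17.W07C7 RhIdea6.G17.W07C7.Rev6 RhIdea6.G18.W07C8.Law421BirthS RhIdea6.G19.W07C11.Seam RhIdea6.G20.W07C12.Frac
  RhIdea6.G20.W07C12.StColP RhW07.C12.FieldSplit RhW08.Round1 RhW08.StSwap RhW08.Round2 RhW08.QuadW RhW08.SealSwapQ in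
open RhW08.SealSwap (PBot) in
/-- ★★★ (K) **R1a′ `FarChildExistsLawSep` AT A SIMPLE LOWEST ZERO with `Im v < R/4` and generic feet — PROVED.**  In an `EngineHyps5 2` frame,
at a CHARGED level `j` (so `¬ TiltReady`: no NL event of level `j` in the window `|x − x₀| < (j+3)R/2`, which contains the closed diameter of
the lowest band state `v`), for `v` lowest, simple, isolated (`R/2`), separated (C′) with `Im v < R/4` and `f⁽ʲ⁺¹⁾(Re v ± Im v) ≠ 0`:
there IS a moving upper child `w` of `f⁽ʲ⁺¹⁾` with `f⁽ʲ⁾ w ≠ 0` in the closed Jensen disc `‖w − Re v‖ ≤ |Im v|` — R1a′'s conclusion verbatim.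
No weak-field / strong-field hypothesis: the winding count (§2) replaces the field dichotomy. -/
theorem farChild_of_sep_simple {η : ℝ} {f : ℂ → ℂ} {x₀ s hmax R Hs : ℝ} {B : ℕ} (hE : EngineHyps5 2 η f x₀ s hmax R Hs B)
    {j : ℕ} {v : ℂ} (hC : Charged (PTrkSQ PBot) StTrkDQ ReadyR2 η f x₀ s hmax R Hs B j)
    (hlow : IsLowest StTrkDQ η f x₀ s hmax R Hs B j v) (hsimp : iteratedDeriv (j + 1) f v ≠ 0)
    (hiso : ∀ z : ℂ, iteratedDeriv j f z = 0 → |z.re - v.re| < R / 2 → z = v ∨ z = conj v)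
    (hsep : ∀ z : ℂ, iteratedDeriv j f z = 0 → v.im < z.im → v.im + z.im < |v.re - z.re|)
    (hR4 : v.im < R / 4)
    (hfeet : iteratedDeriv (j + 1) f ((v.re : ℂ) + v.im) ≠ 0 ∧ iteratedDeriv (j + 1) f ((v.re : ℂ) - v.im) ≠ 0) :
    ∃ w : ℂ, iteratedDeriv (j + 1) f w = 0 ∧ iteratedDeriv j f w ≠ 0 ∧ 0 < w.im ∧ ‖w - (v.re : ℂ)‖ ≤ |v.im| := by
  have hf : RealEntireLt2 f := RhW08.Column.realEntireLt2_of_hyps hE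
  have hv : iteratedDeriv j f v = 0 := hlow.1.2.1
  have hv0 : 0 < v.im := hlow.1.2.2.1
  have hbud : (max (|v.re - x₀| - R / 2) 0) ^ 2 + (j : ℝ) * v.im ^ 2 ≤ (j : ℝ) * Hs ^ 2 := hlow.1.2.2.2.1
  obtain ⟨-, -, -, hs, hsh, hhR, -, hHs0, -, hHsR, -⟩ := hE
  have hR : 0 < R := by linarith
  -- the closed diameter of `v` lies inside the window of `TiltReady` at level `j`
  have hwin : ∀ x : ℝ, |x - v.re| ≤ v.im → |x - x₀| < ((j : ℝ) + 3) * R / 2 := by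
    intro x hx
    have hm0 : 0 ≤ max (|v.re - x₀| - R / 2) 0 := le_max_right _ _
    have hm1 : |v.re - x₀| - R / 2 ≤ max (|v.re - x₀| - R / 2) 0 := le_max_left _ _
    have hj : (0 : ℝ) ≤ j := Nat.cast_nonneg j
    have hj2 : (j : ℝ) ≤ (j : ℝ) ^ 2 := by
      rcases Nat.eq_zero_or_pos j with h0 | hpos
      · simp [h0]
      · have : (1 : ℝ) ≤ j := by exact_mod_cast hpos
        nlinarith
    have hm2 : (max (|v.re - x₀| - R / 2) 0) ^ 2 ≤ (j : ℝ) * (R / 2) ^ 2 := by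
      have h1 : (max (|v.re - x₀| - R / 2) 0) ^ 2 ≤ (j : ℝ) * Hs ^ 2 := by nlinarith [sq_nonneg v.im]
      have h2 : Hs ^ 2 ≤ (R / 2) ^ 2 := by nlinarith
      nlinarith
    have hm3 : max (|v.re - x₀| - R / 2) 0 ≤ (j : ℝ) * (R / 2) := by
      have h4 : (max (|v.re - x₀| - R / 2) 0) ^ 2 ≤ ((j : ℝ) * (R / 2)) ^ 2 := by nlinarith [sq_nonneg R]
      exact (pow_le_pow_iff_left₀ hm0 (by positivity) two_ne_zero).1 h4
    have h5 := abs_sub_le x v.re x₀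
    nlinarith
  -- `Charged` ⇒ `¬ ReadyR2` at level `j` ⇒ no NL event of level `j` in the window
  have hnoNL : ∀ x : ℝ, |x - v.re| ≤ v.im → ¬ NLEventOf f j x := by
    obtain ⟨v', -, hnr, -⟩ := hC
    intro x hx hNL
    apply hnr
    unfold ReadyR2 CumReady WinOrTilt TiltReady
    exact ⟨j, le_rfl, Or.inr ⟨x, hwin x hx, hNL⟩⟩
  obtain ⟨w, h1, h2, h3, h4⟩ := exists_child_of_separated hf j hv hv0 hsimp hiso hsep hR4 hnoNL hfeet
  exact ⟨w, h1, h2, h3, by rwa [abs_of_pos hv0]⟩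

open RhIdea6.G17.W07C7 RhIdea6.G17.W07C7.Rev6 RhIdea6.G18.W07C8.Law421BirthS RhIdea6.G19.W07C11.Seam RhIdea6.G20.W07C12.Frac
  RhIdea6.G20.W07C12.StColP RhW07.C12.FieldSplit RhW08.Round1 RhW08.StSwap RhW08.Round2 RhW08.QuadW RhW08.SealSwapQ in
open RhW08.SealSwap (PBot) in
/-- (LAW R1a′∘ — R1a′ `FarChildExistsLawSep` (Glue2A-v4a l.53) VERBATIM with three extra binders appended: `v` SIMPLE, `Im v < R/4`, generic
feet.)  Typed here to record exactly what is proved; `FarChildExistsLawSep → FarChildExistsLawSepSimple` is trivial, and the converse is the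
three leaves (multiplicity, the sliver `R/4 ≤ Im v ≤ Hs`, feet degeneracy). -/
def FarChildExistsLawSepSimple : Prop :=
  ∀ (η : ℝ) (f : ℂ → ℂ) (x₀ s hmax R Hs : ℝ) (B : ℕ), EngineHyps5 2 η f x₀ s hmax R Hs B → ∀ (j : ℕ) (v : ℂ),
    Charged (PTrkSQ PBot) StTrkDQ ReadyR2 η f x₀ s hmax R Hs B j → IsLowest StTrkDQ η f x₀ s hmax R Hs B j v →
    (∀ z : ℂ, iteratedDeriv j f z = 0 → |z.re - v.re| < R / 2 → z = v ∨ z = conj v) →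
    (∀ z : ℂ, iteratedDeriv j f z = 0 → v.im < z.im → v.im + z.im < |v.re - z.re|) →
    iteratedDeriv (j + 1) f v ≠ 0 → v.im < R / 4 →
    (iteratedDeriv (j + 1) f ((v.re : ℂ) + v.im) ≠ 0 ∧ iteratedDeriv (j + 1) f ((v.re : ℂ) - v.im) ≠ 0) →
    ∃ w : ℂ, iteratedDeriv (j + 1) f w = 0 ∧ iteratedDeriv j f w ≠ 0 ∧ 0 < w.im ∧ ‖w - (v.re : ℂ)‖ ≤ |v.im|

/-- ★★★ (K) **R1a′∘ HOLDS.** -/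
theorem farChildExistsLawSepSimple_holds : FarChildExistsLawSepSimple :=
  fun _ _ _ _ _ _ _ _ hE _ _ hC hlow hiso hsep hsimp hR4 hfeet => farChild_of_sep_simple hE hC hlow hsimp hiso hsep hR4 hfeet


/-! ## §6 (v2, crit-1 HANDS-39 l.7787 repair of leaf L2) `R/4` REMOVED: the binder becomes LOW-CLEARNESS of the lower-or-equal zoo, and the
existence half is then a COROLLARY of lens-1's LANDED Walsh–Jensen pinning `RhW08.Lens1PinningIso.pinning_of_jensenIsolated'` (dirty feet
allowed; cited, not re-derived) + isolation + simplicity; the count of §2–§4 stays as the sharper statement (uniqueness: `N = #real + 2`). -/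

open RhIdea6.G17.W07C7 RhIdea6.G17.W07C7.Rev6 RhIdea6.G18.W07C8.Law421BirthS RhIdea6.G19.W07C11.Seam RhIdea6.G20.W07C12.Frac
  RhIdea6.G20.W07C12.StColP RhW07.C12.FieldSplit RhW08.Round1 RhW08.StSwap RhW08.Round2 RhW08.QuadW RhW08.SealSwapQ in
open RhW08.SealSwap (PBot) in
open RhW08.Lens1PinningIso (JensenIsolated pinning_of_jensenIsolated') in
/-- ★★★ (K) **R1a′ AT A SIMPLE LOWEST ZERO, NO `R/4`, NO CLEAN FEET** (v2).  In an `EngineHyps5 2` frame, at a CHARGED level `j`, let `v` be lowest, SIMPLE,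
isolated (`R/2`), separated from every taller zero (C′), LOW-CLEAR (every OTHER upper zero `z` of `f⁽ʲ⁾` with `Im z ≤ Im v` has its closed Jensen disc
DISJOINT from `v`'s: `Im v + Im z < |Re v − Re z|`; by isolation such `z` have `|Re z − Re v| ≥ R/2`, so this only bites in the sliver
`Im v + Im z ≥ R/2`).  Then R1a′'s conclusion holds.  PROOF = lens-1's landed `pinning_of_jensenIsolated'` (dirty feet allowed; C′ + low-clearness = `JensenIsolated f j v`; `Charged` kills the NL-event branch on the diameter; `NestedStep` = the
closed Jensen disc; conjugate to the upper half-plane; `f⁽ʲ⁾ w ≠ 0` by isolation + simplicity, the strict `|Re w − Re v| < Im v ≤ R/2` coming from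
`Im w ≠ 0`). -/
theorem farChild_of_pinning {η : ℝ} {f : ℂ → ℂ} {x₀ s hmax R Hs : ℝ} {B : ℕ} (hE : EngineHyps5 2 η f x₀ s hmax R Hs B)
    {j : ℕ} {v : ℂ} (hC : Charged (PTrkSQ PBot) StTrkDQ ReadyR2 η f x₀ s hmax R Hs B j)
    (hlow : IsLowest StTrkDQ η f x₀ s hmax R Hs B j v) (hsimp : iteratedDeriv (j + 1) f v ≠ 0)
    (hiso : ∀ z : ℂ, iteratedDeriv j f z = 0 → |z.re - v.re| < R / 2 → z = v ∨ z = conj v)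
    (hsep : ∀ z : ℂ, iteratedDeriv j f z = 0 → v.im < z.im → v.im + z.im < |v.re - z.re|)
    (hlowclear : ∀ z : ℂ, iteratedDeriv j f z = 0 → 0 < z.im → z.im ≤ v.im → z ≠ v → v.im + z.im < |v.re - z.re|) :
    ∃ w : ℂ, iteratedDeriv (j + 1) f w = 0 ∧ iteratedDeriv j f w ≠ 0 ∧ 0 < w.im ∧ ‖w - (v.re : ℂ)‖ ≤ |v.im| := by
  have hf : Summit.RiemannHypothesis.RiemannHypothesis.Theorems.Splittings.JensenWindow.RealEntireLt2 f :=
    RhW08.Column.realEntireLt2_of_hyps hE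
  have hv : iteratedDeriv j f v = 0 := hlow.1.2.1
  have hv0 : 0 < v.im := hlow.1.2.2.1
  have hvHs : v.im ≤ Hs := hlow.1.2.2.2.2
  have hbud : (max (|v.re - x₀| - R / 2) 0) ^ 2 + (j : ℝ) * v.im ^ 2 ≤ (j : ℝ) * Hs ^ 2 := hlow.1.2.2.2.1
  have hE' := hE
  obtain ⟨-, -, -, hs, hsh, hhR, -, hHs0, -, hHsR, -⟩ := hE'
  have hR : 0 < R := by linarith
  -- the closed diameter of `v` lies inside the window of `TiltReady` at level `j`
  have hwin : ∀ x : ℝ, |x - v.re| ≤ v.im → |x - x₀| < ((j : ℝ) + 3) * R / 2 := by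
    intro x hx
    have hm0 : 0 ≤ max (|v.re - x₀| - R / 2) 0 := le_max_right _ _
    have hm1 : |v.re - x₀| - R / 2 ≤ max (|v.re - x₀| - R / 2) 0 := le_max_left _ _
    have hj : (0 : ℝ) ≤ j := Nat.cast_nonneg j
    have hm2 : (max (|v.re - x₀| - R / 2) 0) ^ 2 ≤ (j : ℝ) * (R / 2) ^ 2 := by
      have h1 : (max (|v.re - x₀| - R / 2) 0) ^ 2 ≤ (j : ℝ) * Hs ^ 2 := by nlinarith [sq_nonneg v.im]
      have h2 : Hs ^ 2 ≤ (R / 2) ^ 2 := by nlinarith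
      nlinarith
    have hm3 : max (|v.re - x₀| - R / 2) 0 ≤ (j : ℝ) * (R / 2) := by
      have hj2 : (j : ℝ) ≤ (j : ℝ) ^ 2 := by
        rcases Nat.eq_zero_or_pos j with h0 | hpos
        · simp [h0]
        · have : (1 : ℝ) ≤ j := by exact_mod_cast hpos
          nlinarith
      have h4 : (max (|v.re - x₀| - R / 2) 0) ^ 2 ≤ ((j : ℝ) * (R / 2)) ^ 2 := by nlinarith [sq_nonneg R]
      exact (pow_le_pow_iff_left₀ hm0 (by positivity) two_ne_zero).1 h4
    have h5 := abs_sub_le x v.re x₀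
    nlinarith
  -- `Charged` ⇒ `¬ ReadyR2` at level `j` ⇒ no NL event of level `j` in the window
  have hnoNL : ∀ x : ℝ, |x - v.re| ≤ v.im → ¬ NLEventOf f j x := by
    obtain ⟨v', -, hnr, -⟩ := hC
    intro x hx hNL
    apply hnr
    unfold ReadyR2 CumReady WinOrTilt TiltReady
    exact ⟨j, le_rfl, Or.inr ⟨x, hwin x hx, hNL⟩⟩
  -- C′ + low-clearness = lens-1's `JensenIsolated`
  have hJ : JensenIsolated f j v := by
    intro c hc hcpos hcv
    rcases le_or_gt c.im v.im with hle | hgt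
    · exact Or.inl (hlowclear c hc hcpos hle hcv)
    · exact Or.inl (hsep c hc hgt)
  rcases pinning_of_jensenIsolated' hE hv hv0 hJ with ⟨w, hw, hwim, hnest⟩ | ⟨x, hx, hNL⟩
  · -- a non-real critical point in the closed Jensen disc; conjugate it into the upper half-plane
    have hd : Differentiable ℂ (iteratedDeriv (j + 1) f) := differentiable_iteratedDeriv_of_entire hf.diff (j + 1)
    have hreal : ∀ x : ℝ, (iteratedDeriv (j + 1) f x).im = 0 := fun x => im_iteratedDeriv_ofReal hf.diff hf.real (j + 1) x
    -- the upper representative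
    obtain ⟨u, hu, hupos, hunest⟩ : ∃ u : ℂ, iteratedDeriv (j + 1) f u = 0 ∧ 0 < u.im ∧ NestedStep v u := by
      rcases lt_or_gt_of_ne hwim with hneg | hpos
      · refine ⟨conj w, ?_, ?_, ?_⟩
        · rw [apply_conj_eq_conj hd hreal, hw, map_zero]
        · rw [conj_im]; linarith
        · unfold NestedStep at hnest ⊢; rw [conj_re, conj_im]; nlinarith
      · exact ⟨w, hw, hpos, hnest⟩
    refine ⟨u, hu, ?_, hupos, ?_⟩
    · -- `f⁽ʲ⁾ u ≠ 0`: else isolation forces `u = v` (simplicity) or `u = v̄` (sign)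
      intro hGu
      have hre : |u.re - v.re| < R / 2 := by
        unfold NestedStep at hunest
        have h1 : (u.re - v.re) ^ 2 < v.im ^ 2 := by nlinarith
        have h2 : |u.re - v.re| < |v.im| := sq_lt_sq.1 h1
        rw [abs_of_pos hv0] at h2
        linarith
      rcases hiso u hGu hre with e | e
      · exact hsimp (e ▸ hu)
      · have := congrArg Complex.im e; rw [conj_im] at this; linarith
    · -- the closed Jensen disc
      unfold NestedStep at hunest
      have h1 : ‖u - (v.re : ℂ)‖ ^ 2 = (u.re - v.re) ^ 2 + u.im ^ 2 := by
        rw [Complex.sq_norm, Complex.normSq_apply, sub_re, sub_im, ofReal_re, ofReal_im, sub_zero]; ring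
      have h2 : ‖u - (v.re : ℂ)‖ ^ 2 ≤ |v.im| ^ 2 := by rw [h1, sq_abs]; exact hunest
      exact (pow_le_pow_iff_left₀ (norm_nonneg _) (abs_nonneg _) two_ne_zero).1 h2
  · exact absurd hNL (hnoNL x hx)

/-- ★ (K) **v2 ⊇ v1's regime.** Under `R/2`-isolation, `Im v < R/4` makes LOW-CLEARNESS automatic (the lower-or-equal zoo sits `≥ R/2 > 2·Im v`
away laterally) — so §6 strictly contains §5's regime (and drops §5's generic-feet hypothesis). -/
theorem lowclear_of_R4 {f : ℂ → ℂ} {j : ℕ} {v : ℂ} {R : ℝ}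
    (hiso : ∀ z : ℂ, iteratedDeriv j f z = 0 → |z.re - v.re| < R / 2 → z = v ∨ z = conj v) (hR4 : v.im < R / 4) :
    ∀ z : ℂ, iteratedDeriv j f z = 0 → 0 < z.im → z.im ≤ v.im → z ≠ v → v.im + z.im < |v.re - z.re| := by
  intro z hz hzpos hle hzv
  have hfar : R / 2 ≤ |z.re - v.re| := by
    by_contra hlt
    push Not at hlt
    rcases hiso z hz hlt with e | e
    · exact hzv e
    · have := congrArg Complex.im e; rw [conj_im] at this; linarith
  rw [abs_sub_comm] at hfar
  linarith

open RhIdea6.G17.W07C7 RhIdea6.G17.W07C7.Rev6 RhIdea6.G18.W07C8.Law421BirthS RhIdea6.G19.W07C11.Seam RhIdea6.G20.W07C12.Frac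
  RhIdea6.G20.W07C12.StColP RhW07.C12.FieldSplit RhW08.Round1 RhW08.StSwap RhW08.Round2 RhW08.QuadW RhW08.SealSwapQ in
open RhW08.SealSwap (PBot) in
/-- (LAW R1a′ᴶ — R1a′ `FarChildExistsLawSep` VERBATIM with two appended binders: `v` SIMPLE, LOW-CLEAR; no `R/4`, no clean feet.)  The honest
residual of R1a′ after v2 is exactly: multiplicity (L1) + the low-clearness of the lowest band state w.r.t. the lower-or-equal zoo BEYOND the strip
(L2ᴶ: `Im v + Im z < |Re v − Re z|` for zeros `z ∉ {v, v̄}` with `0 < Im z ≤ Im v`, automatically true when `Im v + Im z < R/2`). -/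
def FarChildExistsLawSepSimpleJ : Prop :=
  ∀ (η : ℝ) (f : ℂ → ℂ) (x₀ s hmax R Hs : ℝ) (B : ℕ), EngineHyps5 2 η f x₀ s hmax R Hs B → ∀ (j : ℕ) (v : ℂ),
    Charged (PTrkSQ PBot) StTrkDQ ReadyR2 η f x₀ s hmax R Hs B j → IsLowest StTrkDQ η f x₀ s hmax R Hs B j v →
    (∀ z : ℂ, iteratedDeriv j f z = 0 → |z.re - v.re| < R / 2 → z = v ∨ z = conj v) →
    (∀ z : ℂ, iteratedDeriv j f z = 0 → v.im < z.im → v.im + z.im < |v.re - z.re|) →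
    iteratedDeriv (j + 1) f v ≠ 0 →
    (∀ z : ℂ, iteratedDeriv j f z = 0 → 0 < z.im → z.im ≤ v.im → z ≠ v → v.im + z.im < |v.re - z.re|) →
    ∃ w : ℂ, iteratedDeriv (j + 1) f w = 0 ∧ iteratedDeriv j f w ≠ 0 ∧ 0 < w.im ∧ ‖w - (v.re : ℂ)‖ ≤ |v.im|

/-- ★★★ (K) **R1a′ᴶ HOLDS** (v2: no `R/4`, no clean feet). -/
theorem farChildExistsLawSepSimpleJ_holds : FarChildExistsLawSepSimpleJ :=
  fun _ _ _ _ _ _ _ _ hE _ _ hC hlow hiso hsep hsimp hlc => farChild_of_pinning hE hC hlow hsimp hiso hsep hlc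


end RhW08.ChildCount
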